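import Literature.AlgebraicGeometry.GroupSchemes.GeneralLinearGroupScheme
import HarnessLib

/-!
# `GL_{n,S}`: universal points, and `S`-points versus absolute points

A theorems-only sequel of `GroupSchemes/GeneralLinearGroupScheme.lean` (Görtz–Wedhorn I,
Example 4.43 (1), p. 116: `GL_n(T) := GL_n(Γ(T, 𝒪_T))`, `GL_{n,S} := GL_n ×_ℤ S`), spelling out the
Yoneda bookkeeping that consumers of the functor of points use:

* §1 `points_symm_apply` (the morphism of a matrix: `T → Spec Γ(T) → GL_n` along `liftHom g`),
  `points_eq_pointOfHom`, **`points_id`** (the universal point = the generic matrix in `Γ(GL_n, 𝒪)`),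
  `points_eq_map_points_id` (every point is the universal point pulled back);
* §2 `forgetAdjStar_homEquiv_symm_apply` (`Over.forget ⊣ Over.star` transposes `f` to `f.left ≫ p₂`),
  **`pointsOver_eq_points`** (`S`-points are absolute points of `f.left ≫ p₂`),
  `pointsOver_symm_left` (`= prod.lift T.hom (absolute point)`), `pointsOver_symm_left_fst/snd`,
  **`pointsOver_id`** (the universal `S`-point), `pointsOver_eq_map_pointsOver_id`,
  `pointsOver_injective`.

## References

* U. Görtz, T. Wedhorn, *Algebraic Geometry I: Schemes*, 2nd ed. (2020): (4.15) and Example 4.43 (1)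
  (p. 116). [GortzWedhorn2020]

## Design notes

* Consumer: `GroupSchemes/GeneralLinearGroupActionProjectiveSpaceScheme.lean` (the action of
  `GL_{m+1,S}` on `𝐏^m_S`, built at the universal point) and later F-7/F-8 files of cell
  hodgecm-mathlib.
* Proof style: in this `Scheme`/`Over S` context `rw` under `Γ(-, ⊤)` / `prod.snd` routinely fails
  with "motive is not type correct", so the proofs are `Eq.trans` / `exact` chains.
* Mathlib / Literature searches: `Adjunction.homEquiv_unit/_counit`, `Over.forgetAdjStar_counit_app`
  (`= prod.snd`), `Over.forgetAdjStar_unit_app_left`, `Limits.prod.hom_ext`; Literature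
  `GeneralLinearGroupScheme.*` (p756923). Nothing restated.
-/

universe u

open CategoryTheory Limits Opposite AlgebraicGeometry

noncomputable section

namespace Literature.AlgebraicGeometry.GroupSchemes

namespace GeneralLinearGroupScheme

variable {n : Type} [Fintype n] [DecidableEq n] {S : Scheme.{u}}

/-! ### §1 Absolute points: the inverse of `points` and the universal point -/

/-- The morphism `T → GL_n` attached to `g ∈ GL_n(Γ(T, 𝒪_T))`: `T → Spec Γ(T) → Spec ℤ[x_{ij}][det⁻¹]`
along `liftHom g`. [cite: GortzWedhorn2020, Example 4.43 (1), p. 116] -/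
theorem points_symm_apply (T : Scheme.{u}) (g : Matrix.GeneralLinearGroup n Γ(T, ⊤)) :
    (points T).symm g = T.toSpecΓ ≫ Spec.map (CommRingCat.ofHom (liftHom g)) := by
  unfold points
  rw [Equiv.symm_trans_apply, specHomEquiv_symm_apply, homEquivGL_symm_apply]

/-- `points` read through the pull-back on global sections: `points T f = pointOfHom (f^*)` with
`f^* = (ΓSpecIso).inv ≫ f.appTop`. [cite: GortzWedhorn2020, Example 4.43 (1), p. 116] -/
theorem points_eq_pointOfHom (T : Scheme.{u}) (f : T ⟶ GLScheme.{u} n) :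
    points T f = pointOfHom ((Scheme.ΓSpecIso (.of (coordRing.{u} n))).inv ≫ f.appTop).hom := by
  rw [points_apply, specHomEquiv_apply, homEquivGL_apply]

/-- **The universal point** of `GL_n`: the identity of `GL_n` corresponds to the generic matrix read in
`Γ(GL_n, 𝒪) ≅ ℤ[x_{ij}][det⁻¹]`. [cite: GortzWedhorn2020, Example 4.43 (1), p. 116] -/
theorem points_id :
    points (GLScheme.{u} n) (𝟙 _) = pointOfHom (Scheme.ΓSpecIso (.of (coordRing.{u} n))).inv.hom := by
  rw [points_eq_pointOfHom, Scheme.Hom.id_appTop, Category.comp_id]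

/-- Every point is the universal point pulled back: `points T f = GL_n(f^*) (points GL_n 𝟙)`.
[cite: GortzWedhorn2020, Example 4.43 (1), p. 116] -/
theorem points_eq_map_points_id (T : Scheme.{u}) (f : T ⟶ GLScheme.{u} n) :
    points T f = Matrix.GeneralLinearGroup.map f.appTop.hom (points (GLScheme.{u} n) (𝟙 _)) := by
  rw [← points_comp, Category.comp_id]

/-! ### §2 `S`-points versus absolute points -/

/-- The `Over.forget ⊣ Over.star` transpose of `f : T → GL_{n,S}` is `f.left ≫ p₂ : T.left → GL_n`.
[cite: GortzWedhorn2020, Example 4.43 (1), p. 116] -/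
theorem forgetAdjStar_homEquiv_symm_apply (T : Over S) (f : T ⟶ GLOver n S) :
    ((Over.forgetAdjStar S).homEquiv T (GLScheme.{u} n)).symm f = f.left ≫ prod.snd := by
  rw [Adjunction.homEquiv_counit, Over.forgetAdjStar_counit_app, Over.forget_map]
  rfl

/-- **`S`-points are absolute points of the second projection**:
`pointsOver T f = points T.left (f.left ≫ p₂)`. [cite: GortzWedhorn2020, Example 4.43 (1), p. 116] -/
theorem pointsOver_eq_points (T : Over S) (f : T ⟶ GLOver n S) :
    pointsOver T f = points T.left (f.left ≫ prod.snd) := by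
  rw [pointsOver_apply, forgetAdjStar_homEquiv_symm_apply]

/-- The `S`-point attached to `g ∈ GL_n(Γ(T, 𝒪_T))`, transposed back along `Over.forget ⊣ Over.star`,
is the absolute point of `g`. [cite: GortzWedhorn2020, Example 4.43 (1), p. 116] -/
theorem forgetAdjStar_homEquiv_symm_pointsOver_symm (T : Over S) (g : Matrix.GeneralLinearGroup n Γ(T.left, ⊤)) :
    ((Over.forgetAdjStar S).homEquiv T (GLScheme.{u} n)).symm ((pointsOver T).symm g) =
      (points T.left).symm g :=
  Equiv.symm_apply_apply _ _

/-- `(pointsOver T).symm g` composed with the second projection is the absolute point of `g`.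
[cite: GortzWedhorn2020, Example 4.43 (1), p. 116] -/
theorem pointsOver_symm_left_snd (T : Over S) (g : Matrix.GeneralLinearGroup n Γ(T.left, ⊤)) :
    ((pointsOver T).symm g).left ≫ prod.snd = (points T.left).symm g := by
  rw [← forgetAdjStar_homEquiv_symm_apply, forgetAdjStar_homEquiv_symm_pointsOver_symm]

/-- `(pointsOver T).symm g` composed with the first projection is the structure map of `T`.
[cite: GortzWedhorn2020, Example 4.43 (1), p. 116] -/
theorem pointsOver_symm_left_fst (T : Over S) (g : Matrix.GeneralLinearGroup n Γ(T.left, ⊤)) :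
    ((pointsOver T).symm g).left ≫ prod.fst = T.hom := by
  have h := Over.w ((pointsOver T).symm g)
  rw [GLOver_hom] at h
  exact h

/-- The underlying morphism of the `S`-point attached to `g ∈ GL_n(Γ(T, 𝒪_T))` is
`(structure map, absolute point) : T → S × GL_n`. [cite: GortzWedhorn2020, Example 4.43 (1), p. 116] -/
theorem pointsOver_symm_left (T : Over S) (g : Matrix.GeneralLinearGroup n Γ(T.left, ⊤)) :
    ((pointsOver T).symm g).left = prod.lift T.hom ((points T.left).symm g) := by
  apply Limits.prod.hom_ext
  · exact (pointsOver_symm_left_fst T g).trans (prod.lift_fst _ _).symm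
  · exact (pointsOver_symm_left_snd T g).trans (prod.lift_snd _ _).symm

/-- **The universal `S`-point**: `pointsOver (𝟙_{GL_{n,S}})` is the universal point of `GL_n` pulled
back along `p₂ : S × GL_n → GL_n`. [cite: GortzWedhorn2020, Example 4.43 (1), p. 116] -/
theorem pointsOver_id :
    pointsOver (GLOver n S) (𝟙 _) =
      Matrix.GeneralLinearGroup.map (prod.snd : S ⨯ GLScheme.{u} n ⟶ _).appTop.hom
        (points (GLScheme.{u} n) (𝟙 _)) := by
  rw [pointsOver_eq_points, Over.id_left, Category.id_comp, points_eq_map_points_id]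
  rfl

/-- Every `S`-point is the universal `S`-point pulled back. [cite: GortzWedhorn2020, Example 4.43 (1), p. 116] -/
theorem pointsOver_eq_map_pointsOver_id (T : Over S) (f : T ⟶ GLOver n S) :
    pointsOver T f = Matrix.GeneralLinearGroup.map f.left.appTop.hom (pointsOver (GLOver n S) (𝟙 _)) := by
  rw [← pointsOver_comp, Category.comp_id]

/-- `pointsOver` is injective (so two `S`-morphisms into `GL_{n,S}` agree iff their matrices do).
[cite: GortzWedhorn2020, Example 4.43 (1), p. 116] -/
theorem pointsOver_injective (T : Over S) : Function.Injective (pointsOver (n := n) T) :=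
  (pointsOver T).injective

end GeneralLinearGroupScheme

end Literature.AlgebraicGeometry.GroupSchemes
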